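import Summits.KontsevichZagierPeriods.KontsevichZagierPeriods.Theorems.ValuedFieldSpecialisationCTConstructionTypedExpansion
import Summits.KontsevichZagierPeriods.KontsevichZagierPeriods.Theorems.ValuedFieldSpecialisationCTConstructionSortedTypedElementary
import Summits.KontsevichZagierPeriods.KontsevichZagierPeriods.Theorems.ValuedFieldSpecialisationClassLevelExpansionFibreDimOneElementaryA
import Literature.NumberTheory.Transcendental.KZFibredRelations

/-!
# Route ValuedFieldSpecialisation — crux `CTConstruction`: state calculus of the dilation elimination

Helper toward crux stmt-KontsevichZagierPeriods-3495 (`CTConstruction`), line `registered`, reshape r3 (the class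
core `stub_specialFibreRigidityOfEval` from PURE + log2-cancellation). The elimination runs on a FIXED finite
universe of typed elementary families `Rep i S` (`i : Fin k` an elementary generator with exponent `p i / Q`,
block size `B i`, coefficient representation `r i`; `S ⊆ Fin (B i)` the set of block coordinates of type `[μ, 1]`,
`μ = 2^{-Q}`, the others of type `[s, 1]`), an elimination STATE being an integer coefficient vector
`c : (i : Fin k) → Finset (Fin (B i)) → ℤ` with class `D c = Σ_i Σ_S c i S • [Rep i S]`. This file proves the
bookkeeping identities the induction (`…CTConstructionCoreReduction.lean`) needs:

* `theta_of_rep_sub_mem`: the dilation operator `Θ = slabMap 0 1 ∘ lift T` acts on one typed family by the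
  binomial law `Θ [Rep i S] ≡ 2^{p i} Σ_{U ⊇ S} [Rep i U]` (from the landed one-step expansion
  `stub_typedExpansion` and uniqueness of typed families, `IntegralRep.ext'`);
* `theta_D_sub_D_mem`, `thetaIter_D_sub_D_mem`: hence `Θⁿ (D c) ≡ D (Θ̂ⁿ c)` for the coefficient operator
  `Θ̂ c i U = 2^{p i} Σ_{S ⊆ U} c i S`;
* `iterate_coeff_apply`: `Θ̂ⁿ` acts componentwise in `i`;
* `exists_sortPerm`, `exists_sorted_elementary`: a typed family of shape `S` with `|Sᶜ| = b` is, after sorting its block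
  (a fibred relabelling) and the recast of `stub_sorted_typed_elementary`, an elementary divergent product of the route
  over `L-box × r`;
* `elementary_domain_eq_typed_empty`: the route's elementary generator `P(p, q, b, d, r)` is the typed family of shape
  `∅` for the common denominator `Q` (exponent `p · (Q / q)`).

No definitions (the state calculus is written out in each statement). Sources: M. Kontsevich, D. Zagier, *Periods*
(2001), §1.2; the encoding is this route's.
-/

noncomputable section

namespace Summit.KontsevichZagierPeriods.ValuedFieldSpecialisation

open MeasureTheory Set Filter
open scoped Topology
open Literature.NumberTheory.Transcendental Literature.NumberTheory.Transcendental.KZ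

/-! ### Elementary bookkeeping -/

/-- `(2^p)^Q · ((1/2)^Q)^p = 1` in `ℝ`. [folklore] -/
theorem two_pow_pow_mul_half_pow_pow (Q p : ℕ) :
    ((2 ^ p : ℕ) : ℝ) ^ Q * ((((1 / 2 : ℚ) ^ Q : ℚ)) : ℝ) ^ p = 1 := by
  push_cast
  rw [← pow_mul, ← pow_mul, mul_comm Q p, ← mul_pow]
  norm_num

/-- `0 < (1/2)^Q` in `ℚ`. [folklore] -/
theorem half_pow_pos (Q : ℕ) : (0 : ℚ) < (1 / 2 : ℚ) ^ Q := by positivity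

/-- `(1/2)^Q ≤ 1` in `ℚ`. [folklore] -/
theorem half_pow_le_one (Q : ℕ) : (1 / 2 : ℚ) ^ Q ≤ 1 :=
  pow_le_one₀ (by norm_num) (by norm_num)

/-- The subsets of `U` are exactly the finsets below `U`. [folklore] -/
theorem filter_subset_eq_powerset {B : ℕ} (U : Finset (Fin B)) :
    (Finset.univ.filter fun S : Finset (Fin B) => S ⊆ U) = U.powerset := by
  ext S; simp

/-- Swapping the double sum `Σ_S Σ_{U ⊇ S}` into `Σ_U Σ_{S ⊆ U}`, with coefficients collected. [folklore] -/
theorem sum_zsmul_sum_supset_eq {B : ℕ} {M : Type*} [AddCommGroup M] (a : ℤ) (c : Finset (Fin B) → ℤ)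
    (x : Finset (Fin B) → M) :
    (∑ S : Finset (Fin B), c S • (a • ∑ U ∈ Finset.univ.filter (fun U : Finset (Fin B) => S ⊆ U), x U)) =
      ∑ U : Finset (Fin B), (a * ∑ S ∈ U.powerset, c S) • x U := by
  have h1 : ∀ S : Finset (Fin B), c S • (a • ∑ U ∈ Finset.univ.filter (fun U : Finset (Fin B) => S ⊆ U), x U) =
      ∑ U : Finset (Fin B), if S ⊆ U then (a * c S) • x U else 0 := by
    intro S
    rw [Finset.smul_sum, Finset.smul_sum, Finset.sum_filter]
    refine Finset.sum_congr rfl fun U _ => ?_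
    split_ifs
    · rw [smul_smul, mul_comm]
    · rfl
  simp_rw [h1]
  rw [Finset.sum_comm]
  refine Finset.sum_congr rfl fun U _ => ?_
  rw [← Finset.sum_filter, filter_subset_eq_powerset, Finset.mul_sum, Finset.sum_smul]

/-! ### The dilation operator on the universe of typed families -/

section Universe

variable {Q k : ℕ} {p B d : Fin k → ℕ} {r : (i : Fin k) → IntegralRep (d i)}
  {Rep : (i : Fin k) → Finset (Fin (B i)) → IntegralRep (B i + d i + 1 + 1)}
  (hRd : ∀ (i : Fin k) (S : Finset (Fin (B i))), (Rep i S).domain = {z | ∃ (s u : ℝ) (t : Fin (B i) → ℝ) (w : Fin (d i) → ℝ), z = Matrix.vecCons s (Matrix.vecCons u (Fin.append t w)) ∧ 0 < s ∧ s < 1 ∧ 0 < u ∧ u ^ Q * s ^ p i < 1 ∧ (∀ j, ((if j ∈ S then (1 / 2 : ℚ) ^ Q else 1 : ℚ) : ℝ) * s ^ (if j ∈ S then 0 else 1) ≤ t j ∧ t j ≤ 1) ∧ w ∈ (r i).domain})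
  (hRi : ∀ (i : Fin k) (S : Finset (Fin (B i))), (Rep i S).integrand = (fun z => (∏ j : Fin (B i), (z (Fin.castAdd (d i) j).succ.succ)⁻¹) * (r i).integrand (fun l : Fin (d i) => z (Fin.natAdd (B i) l).succ.succ)))
  {T : (Σ n, IntegralRep n) → FormalRep}
  (hT : ∀ (n : ℕ) (ρ : IntegralRep (n + 1)), ∃ ρ' : IntegralRep (n + 1), T ⟨n + 1, ρ⟩ = of ρ' ∧
    ρ'.domain = {z | Function.update z 0 ((((1 / 2 : ℚ) ^ Q : ℚ) : ℝ) * z 0) ∈ ρ.domain} ∧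
    ρ'.integrand = fun z => ρ.integrand (Function.update z 0 ((((1 / 2 : ℚ) ^ Q : ℚ) : ℝ) * z 0)))

include hRd hRi hT in
/-- **`Θ` on one typed family of the universe**: `Θ [Rep i S] ≡ 2^{p i} • Σ_{U ⊇ S} [Rep i U]` modulo fibred
relations (one-step expansion `stub_typedExpansion`; the pieces it produces ARE the `Rep i U` by uniqueness of a
representation with given domain and integrand, `IntegralRep.ext'`). [folklore] -/
theorem theta_of_rep_sub_mem (i : Fin k) (S : Finset (Fin (B i))) :
    slabMap 0 1 (FreeAbelianGroup.lift T (of (Rep i S))) -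
      (2 ^ p i : ℕ) • ∑ U ∈ Finset.univ.filter (fun U : Finset (Fin (B i)) => S ⊆ U), of (Rep i U) ∈
      fibredRelations := by
  obtain ⟨ρ', hρ', hdom', hint'⟩ := hT _ (Rep i S)
  have hθ : slabMap 0 1 (FreeAbelianGroup.lift T (of (Rep i S))) = of (ρ'.slabRestrict 0 1) := by
    have : FreeAbelianGroup.lift T (of (Rep i S)) = T ⟨_, Rep i S⟩ := FreeAbelianGroup.lift_apply_of _ _
    rw [this, hρ', slabMap_of]
  obtain ⟨f, hf, hrel⟩ := stub_typedExpansion Q (p i) (2 ^ p i) (B i) (d i) ((1 / 2 : ℚ) ^ Q) (r i) S (Rep i S)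
    (ρ'.slabRestrict 0 1) (half_pow_pos Q) (half_pow_le_one Q) (pow_pos two_pos _)
    (two_pow_pow_mul_half_pow_pow Q (p i)) (hRd i S) (hRi i S)
    (by rw [IntegralRep.domain_slabRestrict, hdom']) (by rw [IntegralRep.integrand_slabRestrict, hint'])
  have hfeq : ∀ U ∈ Finset.univ.filter (fun U : Finset (Fin (B i)) => S ⊆ U), of (f U) = of (Rep i U) := by
    intro U hU
    rw [Finset.mem_filter] at hU
    rw [IntegralRep.ext' ((hf U hU.2).1.trans (hRd i U).symm) ((hf U hU.2).2.trans (hRi i U).symm)]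
  rw [hθ, ← Finset.sum_congr rfl hfeq]
  exact hrel

include hRd hRi hT in
/-- **`Θ (D c) ≡ D (Θ̂ c)`**: on the class `D c = Σ_i Σ_S c i S • [Rep i S]` of a state the dilation operator acts
through the coefficient operator `Θ̂ c i U = 2^{p i} Σ_{S ⊆ U} c i S`, modulo fibred relations. [folklore] -/
theorem theta_D_sub_D_mem (c : (i : Fin k) → Finset (Fin (B i)) → ℤ) :
    slabMap 0 1 (FreeAbelianGroup.lift T (∑ i, ∑ S : Finset (Fin (B i)), c i S • of (Rep i S))) -
      ∑ i, ∑ U : Finset (Fin (B i)), ((2 ^ p i : ℕ) * ∑ S ∈ U.powerset, c i S : ℤ) • of (Rep i U) ∈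
      fibredRelations := by
  set Θ : FormalRep →+ FormalRep := (slabMap 0 1).comp (FreeAbelianGroup.lift T) with hΘ
  have hΘapp : ∀ x, slabMap 0 1 (FreeAbelianGroup.lift T x) = Θ x := fun x => rfl
  have hswap : ∀ i, (∑ U : Finset (Fin (B i)), ((2 ^ p i : ℕ) * ∑ S ∈ U.powerset, c i S : ℤ) • of (Rep i U)) =
      ∑ S : Finset (Fin (B i)), c i S • (((2 ^ p i : ℕ) : ℤ) •
        ∑ U ∈ Finset.univ.filter (fun U : Finset (Fin (B i)) => S ⊆ U), of (Rep i U)) :=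
    fun i => (sum_zsmul_sum_supset_eq ((2 ^ p i : ℕ) : ℤ) (c i) (fun U => of (Rep i U))).symm
  simp_rw [hswap]
  rw [hΘapp, map_sum, ← Finset.sum_sub_distrib]
  refine fibredRelations.sum_mem fun i _ => ?_
  rw [map_sum, ← Finset.sum_sub_distrib]
  refine fibredRelations.sum_mem fun S _ => ?_
  rw [map_zsmul, ← smul_sub]
  refine fibredRelations.zsmul_mem ?_ _
  rw [← hΘapp, natCast_zsmul]
  exact theta_of_rep_sub_mem hRd hRi hT i S

omit hRd hRi hT in
/-- Iterates of the additive map `Θ` are additive. [folklore] -/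
theorem thetaIter_sub (n : ℕ) (x y : FormalRep) :
    Nat.iterate (fun v => slabMap 0 1 (FreeAbelianGroup.lift T v)) n (x - y) =
      Nat.iterate (fun v => slabMap 0 1 (FreeAbelianGroup.lift T v)) n x -
        Nat.iterate (fun v => slabMap 0 1 (FreeAbelianGroup.lift T v)) n y := by
  induction n generalizing x y with
  | zero => rfl
  | succ n ih =>
    simp only [Function.iterate_succ_apply]
    rw [← ih, map_sub, map_sub]

omit hRd hRi hT in
/-- Iterates of `Θ` preserve fibred relations as soon as `Θ` does. [folklore] -/
theorem thetaIter_mem_of (hQT : ∀ x ∈ fibredRelations, slabMap 0 1 (FreeAbelianGroup.lift T x) ∈ fibredRelations)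
    (n : ℕ) {x : FormalRep} (hx : x ∈ fibredRelations) :
    Nat.iterate (fun v => slabMap 0 1 (FreeAbelianGroup.lift T v)) n x ∈ fibredRelations := by
  induction n generalizing x with
  | zero => simpa using hx
  | succ m ihm => rw [Function.iterate_succ_apply]; exact ihm (hQT x hx)

include hRd hRi hT in
/-- **`Θⁿ (D c) ≡ D (Θ̂ⁿ c)`** modulo fibred relations. [folklore] -/
theorem thetaIter_D_sub_D_mem (hQT : ∀ x ∈ fibredRelations, slabMap 0 1 (FreeAbelianGroup.lift T x) ∈ fibredRelations)
    (n : ℕ) (c : (i : Fin k) → Finset (Fin (B i)) → ℤ) :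
    Nat.iterate (fun v => slabMap 0 1 (FreeAbelianGroup.lift T v)) n (∑ i, ∑ S : Finset (Fin (B i)), c i S • of (Rep i S)) -
      ∑ i, ∑ U : Finset (Fin (B i)),
        Nat.iterate (fun (c' : (i : Fin k) → Finset (Fin (B i)) → ℤ) => fun (i : Fin k) (U : Finset (Fin (B i))) =>
          ((2 ^ p i : ℕ) * ∑ S ∈ U.powerset, c' i S : ℤ)) n c i U • of (Rep i U) ∈ fibredRelations := by
  induction n generalizing c with
  | zero => simp
  | succ n ih =>
    rw [Function.iterate_succ_apply, Function.iterate_succ_apply]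
    set c₁ := (fun (c' : (i : Fin k) → Finset (Fin (B i)) → ℤ) => fun (i : Fin k) (U : Finset (Fin (B i))) =>
      ((2 ^ p i : ℕ) * ∑ S ∈ U.powerset, c' i S : ℤ)) c with hc₁
    have h1 := theta_D_sub_D_mem hRd hRi hT c
    have h2 := thetaIter_mem_of hQT n h1
    rw [thetaIter_sub] at h2
    have h3 := ih c₁
    have := fibredRelations.add_mem h2 h3
    convert this using 1
    abel

end Universe

/-- The coefficient operator `Θ̂` and its iterates act componentwise in the generator index `i`. [folklore] -/
theorem iterate_coeff_apply {k : ℕ} {B : Fin k → ℕ} (a : Fin k → ℤ) (n : ℕ)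
    (c : (i : Fin k) → Finset (Fin (B i)) → ℤ) (i : Fin k) :
    Nat.iterate (fun (c' : (i : Fin k) → Finset (Fin (B i)) → ℤ) => fun (i : Fin k) (U : Finset (Fin (B i))) =>
        a i * ∑ S ∈ U.powerset, c' i S) n c i =
      Nat.iterate (fun (f : Finset (Fin (B i)) → ℤ) => fun (U : Finset (Fin (B i))) => a i * ∑ S ∈ U.powerset, f S) n (c i) := by
  induction n generalizing c with
  | zero => rfl
  | succ n ih =>
    rw [Function.iterate_succ_apply, Function.iterate_succ_apply, ih]

/-! ### Sorting the block of a typed family -/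

/-- **Sorting permutation**: if `Sᶜ` has `b` elements there is a permutation `σ` of `Fin B` carrying the first
`b` indices onto `Sᶜ` and the remaining ones onto `S`. [folklore] -/
theorem exists_sortPerm {B b : ℕ} (S : Finset (Fin B)) (hS : (Finset.univ \ S).card = b) :
    ∃ σ : Equiv.Perm (Fin B), ∀ j, σ j ∈ S ↔ ¬ ((j : ℕ) < b) := by
  classical
  have hbB : b ≤ B := by
    rw [← hS]; exact (Finset.card_le_univ _).trans (by simp)
  -- cardinalities of the four pieces
  have hlt : (Finset.univ.filter fun j : Fin B => (j : ℕ) < b).card = b := by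
    have h : (Finset.univ.filter fun j : Fin B => (j : ℕ) < b).map Fin.valEmbedding = Finset.range b := by
      ext x
      simp only [Finset.mem_map, Finset.mem_filter, Finset.mem_univ, true_and, Fin.valEmbedding_apply,
        Finset.mem_range]
      constructor
      · rintro ⟨j, hj, rfl⟩; exact hj
      · intro hx; exact ⟨⟨x, lt_of_lt_of_le hx hbB⟩, hx, rfl⟩
    rw [← Finset.card_map, h, Finset.card_range]
  have hc1 : Fintype.card {j : Fin B // (j : ℕ) < b} = Fintype.card {j : Fin B // j ∉ S} := by
    rw [Fintype.card_subtype, Fintype.card_subtype, hlt]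
    rw [← hS]; congr 1; ext j; simp
  have hc2 : Fintype.card {j : Fin B // ¬ (j : ℕ) < b} = Fintype.card {j : Fin B // ¬ j ∉ S} := by
    have h1 := Fintype.card_subtype_compl (fun j : Fin B => (j : ℕ) < b)
    have h2 := Fintype.card_subtype_compl (fun j : Fin B => j ∉ S)
    rw [h1, h2, hc1]
  obtain ⟨e₁⟩ := Fintype.card_eq.mp hc1
  obtain ⟨e₂⟩ := Fintype.card_eq.mp hc2
  refine ⟨Equiv.subtypeCongr e₁ e₂, fun j => ?_⟩
  by_cases hj : (j : ℕ) < b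
  · have happ : Equiv.subtypeCongr e₁ e₂ j = e₁ ⟨j, hj⟩ := by
      simp only [Equiv.subtypeCongr, Equiv.trans_apply, Equiv.sumCongr_apply]
      rw [Equiv.sumCompl_symm_apply_of_pos (p := fun j : Fin B => (j : ℕ) < b) hj]
      rfl
    rw [happ]
    simpa [hj] using (e₁ ⟨j, hj⟩).2
  · have happ : Equiv.subtypeCongr e₁ e₂ j = e₂ ⟨j, hj⟩ := by
      simp only [Equiv.subtypeCongr, Equiv.trans_apply, Equiv.sumCongr_apply]
      rw [Equiv.sumCompl_symm_apply_of_neg (p := fun j : Fin B => (j : ℕ) < b) hj]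
      rfl
    rw [happ]
    simpa [hj] using (e₂ ⟨j, hj⟩).2

/-- Pointwise form of the sorted shape functions (`Fin.append` of constants versus the `j < b` test). [folklore] -/
theorem ite_val_lt_eq_append {b k' : ℕ} {α : Type*} (x y : α) (j : Fin (b + k')) :
    (if (j : ℕ) < b then x else y) = Fin.append (fun _ : Fin b => x) (fun _ : Fin k' => y) j := by
  refine Fin.addCases (fun i => ?_) (fun i => ?_) j
  · simp [Fin.append_left]
  · simp [Fin.append_right]

/-- **Sorted typed family = elementary product (recast)**: wrapper around `stub_sorted_typed_elementary` for a block
of size `B = b + k'` described by the `j < b` test. [folklore] -/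
theorem exists_sorted_elementary (Q p B b k' d : ℕ) (hB : B = b + k') (μ : ℚ) (hμ : 0 < μ) (hμ1 : μ ≤ 1)
    (r : IntegralRep d) (Lk : IntegralRep k') (hLd : Lk.domain = {t | ∀ j, (μ : ℝ) ≤ t j ∧ t j ≤ 1})
    (hLi : Lk.integrand = fun t => ∏ j, (t j)⁻¹) (R : IntegralRep (B + d + 1 + 1))
    (hdom : R.domain = {z | ∃ (s u : ℝ) (t : Fin B → ℝ) (w : Fin d → ℝ),
      z = Matrix.vecCons s (Matrix.vecCons u (Fin.append t w)) ∧ 0 < s ∧ s < 1 ∧ 0 < u ∧ u ^ Q * s ^ p < 1 ∧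
        (∀ j : Fin B, ((if (j : ℕ) < b then 1 else μ : ℚ) : ℝ) * s ^ (if (j : ℕ) < b then 1 else 0) ≤ t j ∧ t j ≤ 1) ∧
        w ∈ r.domain})
    (hint : R.integrand = fun z => (∏ j : Fin B, (z (Fin.castAdd d j).succ.succ)⁻¹) *
      r.integrand (fun l : Fin d => z (Fin.natAdd B l).succ.succ)) :
    ∃ P : IntegralRep (b + (k' + d) + 1 + 1),
      P.domain = {z | ∃ (s u : ℝ) (y : Fin b → ℝ) (w : Fin (k' + d) → ℝ),
        z = Matrix.vecCons s (Matrix.vecCons u (Fin.append y w)) ∧ 0 < s ∧ s < 1 ∧ 0 < u ∧ u ^ Q * s ^ p < 1 ∧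
          (∀ j, s ≤ y j ∧ y j ≤ 1) ∧ w ∈ (Lk.prod r).domain} ∧
      P.integrand = (fun z => (∏ j : Fin b, (z (Fin.castAdd (k' + d) j).succ.succ)⁻¹) *
        (Lk.prod r).integrand (fun l : Fin (k' + d) => z (Fin.natAdd b l).succ.succ)) ∧
      of R - of P ∈ fibredRelations := by
  subst hB
  refine stub_sorted_typed_elementary Q p b k' d μ r Lk R hμ hμ1 hLd hLi ?_ hint
  rw [hdom]
  ext z
  simp only [mem_setOf_eq, ite_val_lt_eq_append]

/-! ### The route's elementary generators are the typed families of shape `∅` -/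

/-- For `0 < q ∣ Q'` (`0 < Q'`), the elementary divergent product `P(p, q, b, d, r)` has the domain of the typed
family of shape `∅` with common denominator `Q'` and exponent `p · (Q' / q)`:
`u^q s^p < 1 ↔ (u^q s^p)^{Q'/q} < 1`. [folklore] -/
theorem elementary_domain_eq_typed_empty {p q b d Q' : ℕ} (hq : 0 < q) (hQ' : 0 < Q') (hqQ : q ∣ Q')
    (r : IntegralRep d) (P : IntegralRep (b + d + 1 + 1))
    (hP : P.domain = {z | ∃ (s u : ℝ) (y : Fin b → ℝ) (w : Fin d → ℝ),
      z = Matrix.vecCons s (Matrix.vecCons u (Fin.append y w)) ∧ 0 < s ∧ s < 1 ∧ 0 < u ∧ u ^ q * s ^ p < 1 ∧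
        (∀ j, s ≤ y j ∧ y j ≤ 1) ∧ w ∈ r.domain}) :
    P.domain = {z | ∃ (s u : ℝ) (t : Fin b → ℝ) (w : Fin d → ℝ), z = Matrix.vecCons s (Matrix.vecCons u (Fin.append t w)) ∧ 0 < s ∧ s < 1 ∧ 0 < u ∧ u ^ Q' * s ^ (p * (Q' / q)) < 1 ∧ (∀ j, ((if j ∈ (∅ : Finset (Fin b)) then (1 / 2 : ℚ) ^ Q' else 1 : ℚ) : ℝ) * s ^ (if j ∈ (∅ : Finset (Fin b)) then 0 else 1) ≤ t j ∧ t j ≤ 1) ∧ w ∈ r.domain} := by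
  obtain ⟨m, hm⟩ := hqQ
  have hm0 : m ≠ 0 := by rintro rfl; simp at hm; omega
  have hdiv : Q' / q = m := by rw [hm, Nat.mul_div_cancel_left _ hq]
  have hiff : ∀ {s u : ℝ}, 0 < s → 0 < u → (u ^ q * s ^ p < 1 ↔ u ^ Q' * s ^ (p * (Q' / q)) < 1) := by
    intro s u hs hu
    rw [hdiv, hm, pow_mul, pow_mul, ← mul_pow]
    rw [pow_lt_one_iff_of_nonneg (by positivity) hm0]
  rw [hP]
  ext z
  simp only [mem_setOf_eq, Finset.notMem_empty, if_false, Rat.cast_one, one_mul, pow_one]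
  constructor
  · rintro ⟨s, u, y, w, rfl, hs, hs1, hu, h, hy, hw⟩
    exact ⟨s, u, y, w, rfl, hs, hs1, hu, (hiff hs hu).mp h, hy, hw⟩
  · rintro ⟨s, u, y, w, rfl, hs, hs1, hu, h, hy, hw⟩
    exact ⟨s, u, y, w, rfl, hs, hs1, hu, (hiff hs hu).mpr h, hy, hw⟩

/-- **Registered stub `stub_coreCalculus`** (crux `CTConstruction`, line `registered`, reshape r3): `Θⁿ (D c) ≡ D (Θ̂ⁿ c)`
on the universe of typed families (explicit form of `thetaIter_D_sub_D_mem`). [folklore] -/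
theorem stub_coreCalculus : ∀ (Q : ℕ) (k : ℕ) (p B d : Fin k → ℕ) (r : (i : Fin k) → Literature.NumberTheory.Transcendental.KZ.IntegralRep (d i)) (Rep : (i : Fin k) → Finset (Fin (B i)) → Literature.NumberTheory.Transcendental.KZ.IntegralRep (B i + d i + 1 + 1)), (∀ (i : Fin k) (S : Finset (Fin (B i))), (Rep i S).domain = {z | ∃ (s u : ℝ) (t : Fin (B i) → ℝ) (w : Fin (d i) → ℝ), z = Matrix.vecCons s (Matrix.vecCons u (Fin.append t w)) ∧ 0 < s ∧ s < 1 ∧ 0 < u ∧ u ^ Q * s ^ p i < 1 ∧ (∀ j, ((if j ∈ S then (1 / 2 : ℚ) ^ Q else 1 : ℚ) : ℝ) * s ^ (if j ∈ S then 0 else 1) ≤ t j ∧ t j ≤ 1) ∧ w ∈ (r i).domain}) → (∀ (i : Fin k) (S : Finset (Fin (B i))), (Rep i S).integrand = (fun z => (∏ j : Fin (B i), (z (Fin.castAdd (d i) j).succ.succ)⁻¹) * (r i).integrand (fun l : Fin (d i) => z (Fin.natAdd (B i) l).succ.succ))) → ∀ (T : (Σ n, Literature.NumberTheory.Transcendental.KZ.IntegralRep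 n) → Literature.NumberTheory.Transcendental.KZ.FormalRep), (∀ (n : ℕ) (ρ : Literature.NumberTheory.Transcendental.KZ.IntegralRep (n + 1)), ∃ ρ' : Literature.NumberTheory.Transcendental.KZ.IntegralRep (n + 1), T ⟨n + 1, ρ⟩ = Literature.NumberTheory.Transcendental.KZ.of ρ' ∧ ρ'.domain = {z | Function.update z 0 ((((1 / 2 : ℚ) ^ Q : ℚ) : ℝ) * z 0) ∈ ρ.domain} ∧ ρ'.integrand = fun z => ρ.integrand (Function.update z 0 ((((1 / 2 : ℚ) ^ Q : ℚ) : ℝ) * z 0))) → (∀ x ∈ Literature.NumberTheory.Transcendental.KZ.fibredRelations, Literature.NumberTheory.Transcendental.KZ.slabMap 0 1 (FreeAbelianGroup.lift T x) ∈ Literature.NumberTheory.Transcendental.KZ.fibredRelations) → ∀ (n : ℕ) (c : (i : Fin k) → Finset (Fin (B i)) → ℤ), Nat.iterate (fun v => Literature.NumberTheory.Transcendental.KZ.slabMap 0 1 (FreeAbelianGroup.lift T v)) n (∑ i, ∑ S : Finset (Fin (B i)), c i S • Literature.NumberTheory.Transcendental.KZ.of (Rep i S)) - ∑ i, ∑ U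 : Finset (Fin (B i)), Nat.iterate (fun (c' : (i : Fin k) → Finset (Fin (B i)) → ℤ) => fun (i : Fin k) (U : Finset (Fin (B i))) => ((2 ^ p i : ℕ) * ∑ S ∈ U.powerset, c' i S : ℤ)) n c i U • Literature.NumberTheory.Transcendental.KZ.of (Rep i U) ∈ Literature.NumberTheory.Transcendental.KZ.fibredRelations := by
  intro Q k p B d r Rep hRd hRi T hT hQT n c
  exact thetaIter_D_sub_D_mem hRd hRi hT hQT n c

end Summit.KontsevichZagierPeriods.ValuedFieldSpecialisation
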